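import Summits.BirchSwinnertonDyer.BirchSwinnertonDyer.Theorems.PrintCf2RamifiedOffTYZPartnerShaCassels
import Summits.BirchSwinnertonDyer.BirchSwinnertonDyer.Theorems.PrintCf2RamifiedOffTYZPartnerShaRho
import Literature.NumberTheory.EllipticCurves.TwoIsogenyShaTwoTorsionEqPhi
import Literature.NumberTheory.EllipticCurves.TwoIsogenyShaCountFormula
import Literature.NumberTheory.EllipticCurves.SecondDescentShaExponentProofs
import HarnessLib

/-!
# Crux `PrintCf2.RamifiedOffTYZOfFacts` (stmt-BirchSwinnertonDyer-20509), line `offtyz-v7`, LEAD cycle 21 (cruxlead-20509 g20), part 3/3: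
# `ρ`-RIGIDITY OF THE JUMP-ONE CLASS THROUGH THE PARTNER'S `Ш` — the first theorems of the lineage that CONSUME `#Sel₄(E_n) = 2⁶`

THEOREMS ONLY (no `def`, no named fact introduced, no `sorry`), `--supports stmt-BirchSwinnertonDyer-20509` (C⁺ = item 23431
`RamifiedJumpOneLevelTwoOfFacts`: `2 ∥ 𝓛(n)` on square-free `n ≡ 5,6,7 (8)`, `r_an = 1`, `#Sel₂(E_n) = 2⁵`, `#Sel₄(E_n) = 2⁶`).
HONEST FRAMING: the director's method ceiling of record (p770682, `…SelmerFourNecessity`): no file of the lineage used the hypothesis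
`#Sel₄(E_n) = 2⁶`, which the census B-members show to be load-bearing.  This file connects it to an object the line already computes:
the `2`-torsion of `Ш` of the `2`-isogenous PARTNER `A_n = E_n' : Y² = X³ + 4n²X`, through Tian–Yuan–Zhang's `ρ(n)`.  Inputs: parts 1/2,
the tree's `Ш(E')[φ̂] = 0 ⟹ Ш(E)[2] = Ш(E)[φ]` (`TwoIsogenyShaTwoTorsionEqPhi`, AEC X.6.2(c)), the descent counts of `SecondDescentShaExponentProofs`.
The Cassels–Tate pairing enters ONLY as the named-fact hypothesis `hCT : exists_casselsTate_pairing_adjoint ℚ` (Milne *ADT* I.6.9/6.10(a)/6.13(a)),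
and GZK as `rank_eq_analyticRank_of_analyticRank_le_one` (conjunct 1 of `𝔅_ram`) in the last theorem.  Nothing about BSD is asserted.

On the TWO-PRIME SHAPE `dim S(0,−n²) = 3`, `dim S'(0,−n²) = 2` (the explicit isogeny Selmer groups of `E_n`; on the block-free sector
R2 = {`n = lq`, `l ≡ 1`, `q ≡ 7 (mod 8)`, `(l/q) = 1`}: `Sel^{(φ̂)} = ⟨[−1],[l],[q]⟩`, `Sel^{(φ)} = {1, 2, l, 2l}`, cruxlead g15/g16), square-free
`n > 1`, `rank E_n(ℚ) = 1`, `#Sel₂(E_n) = 2⁵`: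
* **T1** `rhoIndex_ne_one_and_selmerFour_of_partner` (NO Cassels–Tate, needs only `dim S' = 2`): `Ш(A_n)[2] = 0 ⟹ ρ(n) ≠ 0 ∧ #Ш(E_n)[2^∞] = 4
  ∧ #Sel₄(E_n) = 2⁶` — a `2`-torsion-free partner puts the member in the jump-one (G) class AUTOMATICALLY.
* `card_shaTwo_eq_of_rho_of_casselsTate` (CT): **`#Ш(E_n)[2^∞] = 4^{ρ(n)} · #Ш(A_n)[2^∞]`** (as the dichotomy `ρ = 0` / `ρ ≠ 0`).
* **T2** `card_partner_shaTwo_of_selmerFour_of_casselsTate` (CT; USES `#Sel₄ = 2⁶`): on G, `ρ(n) ≠ 0 ⟹ #Ш(A_n)[2^∞] = 1`, `ρ(n) = 0 ⟹ #Ш(A_n)[2^∞] = 4`.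
* **T3** `partner_sha_two_ne_of_not_selmerFour` (no CT): `#Sel₄(E_n) ≠ 2⁶ ⟹ Ш(A_n)[2] ≠ 0` (B-members always have a partner with `2`-torsion in `Ш`).
* **HEADLINE** `partner_sha_two_eq_bot_iff_of_casselsTate` / `…_of_facts`: **`Ш(A_n)[2] = 0 ⟺ ρ(n) ≠ 0 ∧ #Sel₄(E_n) = 2⁶`**.

What this buys the line (LEAD census, crux 20509; memo `Lines/offtyz_v7_PartnerSha.md`): (i) the `Sel₄` datum of C⁺ on R2 is EQUIVALENT
(given `ρ`) to the plain `2`-Selmer dimension of the partner, `dim Sel₂(A_n/ℚ) = 2` — a first-descent object over `ℚ(i)` (Shapiro), no pairing;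
(ii) g15's census law `RhoLawR2` («`ρ(lq) = 1 ⟺ l ≠ x² + 32y²`», 636/636 on G) is thereby the same statement as the Selmer law
«`Ш(A_{lq})[2] = 0 ⟺ ((1+i)/l)₂ = −1`»; (iii) on the sub-sector `Ш(A_n)[2] = 0` the hypothesis `#Sel₄ = 2⁶` of C⁺ is REDUNDANT (T1), so
C⁺ there is legitimately `Sel₄`-free and reads `y_K ∉ 2A_n(ℚ) + A_n(ℚ)_tor` (index of the Heegner point odd); (iv) the B-members are exactly
the `ρ`-law violators plus the `ρ = 0` members with `#Ш(A_n)[2^∞] ≥ 16`.  Beyond-print theorem: NO (Cassels 1965 + descent bookkeeping);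
the analytic half of C⁺ (`2 ∥ 𝓛`) is untouched.  BSD is not proved by any of this; C⁺ (23431) and the crux (20509) stay OPEN.

References: [cite: MilneADT2006, Ch. I, Prop. 6.9, Rem. 6.10(a), Thm. 6.13(a), proof of Thm. 7.3 (p. 98)]; [cite: SilvermanAEC2009, Thm. X.4.2(a),
Prop. X.4.9, proof of Prop. X.6.2(c)]; [cite: TianYuanZhang2017, §1 (ρ(n)), Thm. 1.2]; [cite: HeathBrown1994SelmerCongruentII, §1 (#Sel₂ = 2^{2+s(n)})];
[cite: Darmon2004, Thm. 3.22 (GZK)]; tree: p770682 `…SelmerFourNecessity`, p770400 `…JumpOneLevelTwoIffBSDTwo`, `SecondDescentShaExponentProofs`.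
-/

noncomputable section

open scoped Classical

open WeierstrassCurve Literature.NumberTheory.EllipticCurves
open WeierstrassCurve.Affine WeierstrassCurve.Affine.Point
  Literature.NumberTheory.EllipticCurves.TwoDescentLocal
  Literature.NumberTheory.EllipticCurves.TianYuanZhang2017
  Literature.NumberTheory.EllipticCurves.TianYuanZhang2017.RhoMonskyKernel

namespace Summit.BirchSwinnertonDyer.PrintCf2.PartnerSha

/-! ## §5 The jump-one class: `ρ`-rigidity through the partner's `Ш` -/

/-- AEC X.4.2(a) counted for `φ : E_n → A_n`, on the named model: `#Ш(E_n)[φ] · 2^{rank + 2} = 2^{dim S'(0,−n²)} · #α(E_n(ℚ))`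
(`Ш(E_n)[φ] = Ш(E_n) ∩ im Ξ`, transport of `natCard_sha_inf_range_mul_two_pow`). [cite: SilvermanAEC2009, Thm. X.4.2(a), Prop. X.4.9]
[cite: SilvermanTate2015, §3.6] -/
theorem natCard_shaPhi_mul_two_pow_congruent {n : ℕ} (hn : n ≠ 0) :
    haveI := isElliptic_congruentNumberCurve hn
    Nat.card ↥((congruentNumberCurve n).sha ⊓
        AddMonoidHom.range (G := Additive (SqUnits ℚ)) (congruentNumberCurve n).twoIsogenyTorsorHom) *
        2 ^ ((congruentNumberCurve n).mordellWeilRank + 2) =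
      2 ^ twoIsogenySelmerRank' 0 (-((n : ℤ) ^ 2)) * Nat.card (Set.range (congruentNumberCurve n).xSqClass) := by
  haveI := isElliptic_congruentNumberCurve hn
  have hab := hab_congruent hn
  haveI hE := isElliptic_mk_of_ne_zero (F := ℚ) hab
  have hlit := congruentNumberCurve_eq_mk n
  have h := natCard_sha_inf_range_mul_two_pow (a := 0) (b := -((n : ℤ) ^ 2)) hab
  rw [← natCard_sha_inf_range_twoIsogenyTorsorHom_congr hlit, ← mordellWeilRank_congr hlit,
    ← natCard_range_xSqClass_congr hlit] at h
  exact h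

/-- `#Ш(E_n)[2] = 4` on the class `rank E_n(ℚ) = 1`, `#Sel₂(E_n) = 2⁵` (Heath-Brown's `s(n) = 3`), read on the subgroup
`Ш(E_n) ∩ H¹(ℚ, E_n)[2]` of `H¹(ℚ, E_n)`. [cite: SilvermanAEC2009, Thm. X.4.2] [cite: HeathBrown1994SelmerCongruentII, §1] -/
theorem natCard_sha_inf_torsionBy_two_eq_four {n : ℕ} (hn : n ≠ 0)
    (hr : haveI := isElliptic_congruentNumberCurve hn; (congruentNumberCurve n).mordellWeilRank = 1)
    (h₂ : haveI := isElliptic_congruentNumberCurve hn; Nat.card ((congruentNumberCurve n).selmerGroup 2) = 2 ^ 5) :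
    haveI := isElliptic_congruentNumberCurve hn
    Nat.card ↥((congruentNumberCurve n).sha ⊓ AddSubgroup.torsionBy (congruentNumberCurve n).galH1 2) = 4 := by
  haveI := isElliptic_congruentNumberCurve hn
  have h := (MonskySelmerParity.natCard_shaTorsionBy_two_eq_pow hn (s := 3) (by simpa using h₂)).2
  rw [hr] at h
  rw [← Literature.Algebra.Module.natCard_torsionBy_addSubgroup]
  simpa using h

/-- **THEOREM T1 (no Cassels–Tate input): a `2`-torsion-free partner forces `ρ(n) = 1` AND the jump-one condition.**
Square-free `n`, `rank E_n(ℚ) = 1`, `#Sel₂(E_n) = 2⁵`, `dim S'(0,−n²) = 2` (the `φ`-Selmer group `Sel^{(φ)}(E_n → A_n)` has order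
`4`, as on the block-free two-prime sector R2: `{1, 2, l, 2l}`), and `Ш(A_n/ℚ)[2] = 0` for the partner `A_n = E_n'`. Then
`ρ(n) ≠ 0`, `Ш(E_n)[2^∞] = Ш(E_n)[2]` has order `4`, and `#Sel₄(E_n) = 2⁶` — the member is AUTOMATICALLY in the jump-one (G) class.
Mechanism: `Ш(A_n)[φ̂] = 0 ⟹ Ш(E_n)[2] = Ш(E_n)[φ]` (AEC X.6.2(c)); the count `#Ш(E_n)[φ]·8 = 4·#α` gives `#α = 8 > 4`, so
`ρ ≠ 0`; and `4c = 0 ⟹ 2c ∈ Ш[φ] = ker φ_* ⟹ φ_* c ∈ Ш(A_n)[2] = 0 ⟹ c ∈ Ш[φ] ⟹ 2c = 0`.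
[cite: SilvermanAEC2009, Thm. X.4.2(a), proof of Prop. X.6.2(c)] [cite: TianYuanZhang2017, §1 (ρ(n))] -/
theorem rhoIndex_ne_one_and_selmerFour_of_partner {n : ℕ} (hsq : Squarefree n)
    (hr : haveI := isElliptic_congruentNumberCurve hsq.ne_zero; (congruentNumberCurve n).mordellWeilRank = 1)
    (h₂ : haveI := isElliptic_congruentNumberCurve hsq.ne_zero; Nat.card ((congruentNumberCurve n).selmerGroup 2) = 2 ^ 5)
    (hS' : twoIsogenySelmerRank' 0 (-((n : ℤ) ^ 2)) = 2)
    (hA : ∀ c ∈ (congruentNumberCurve n).twoIsogenyCodomain.sha, 2 • c = 0 → c = 0) :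
    haveI := isElliptic_congruentNumberCurve hsq.ne_zero
    (rhoSubgroup n).index ≠ 1 ∧
      Nat.card (AddCommGroup.primaryComponent (congruentNumberCurve n).sha 2) = 4 ∧
      Nat.card ((congruentNumberCurve n).selmerGroup 4) = 2 ^ 6 := by
  have hn := hsq.ne_zero
  haveI := isElliptic_congruentNumberCurve hn
  -- (a) `Ш(A_n) ∩ im Ξ_{A_n} = ⊥`
  have hA' : (congruentNumberCurve n).twoIsogenyCodomain.sha ⊓
      AddMonoidHom.range (G := Additive (SqUnits ℚ)) (congruentNumberCurve n).twoIsogenyCodomain.twoIsogenyTorsorHom = ⊥ := by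
    rw [eq_bot_iff]
    rintro c ⟨hc, ⟨x, hx⟩⟩
    rw [AddSubgroup.mem_bot]
    exact hA c hc (by rw [← hx]; exact two_nsmul_twoIsogenyTorsorHom _ x)
  -- (b) `Ш(E_n)[2] = Ш(E_n)[φ]`, of order `4`
  have hEq := sha_inf_torsionBy_two_eq_sha_inf_range (congruentNumberCurve n) hA'
  have h4 : Nat.card ↥((congruentNumberCurve n).sha ⊓
      AddMonoidHom.range (G := Additive (SqUnits ℚ)) (congruentNumberCurve n).twoIsogenyTorsorHom) = 4 := by
    rw [← hEq]; exact natCard_sha_inf_torsionBy_two_eq_four hn hr h₂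
  -- (c) `#α = 8`, hence `ρ ≠ 0`
  have hcount := natCard_shaPhi_mul_two_pow_congruent hn
  rw [h4, hr, hS', show (2 : ℕ) ^ (1 + 2) = 8 by norm_num, show (2 : ℕ) ^ 2 = 4 by norm_num] at hcount
  have hα : Nat.card (Set.range (congruentNumberCurve n).xSqClass) = 8 := by omega
  have hρ : (rhoSubgroup n).index ≠ 1 := fun h1 => by
    have := natCard_range_xSqClass_le_four_of_rhoIndex_eq_one hn h1; omega
  -- (d) `4c = 0 ⟹ 2c = 0` on `Ш(E_n)`
  have hstep : ∀ c ∈ (congruentNumberCurve n).sha, 2 • (2 • c) = 0 → 2 • c = 0 := by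
    intro c hc h4c
    have h2c : 2 • c ∈ (congruentNumberCurve n).sha ⊓
        AddMonoidHom.range (G := Additive (SqUnits ℚ)) (congruentNumberCurve n).twoIsogenyTorsorHom := by
      rw [← hEq]; exact ⟨(congruentNumberCurve n).sha.nsmul_mem hc 2, AddSubgroup.torsionBy.nsmul_iff.mpr h4c⟩
    have hker : 2 • c ∈ (galH1Map (congruentNumberCurve n).twoIsogenyGeomHom
        (twoIsogenyGeomHom_smul (congruentNumberCurve n))).ker := by
      rw [← range_twoIsogenyTorsorHom_eq_ker_galH1Map]; exact h2c.2
    have hker' : 2 • galH1Map (congruentNumberCurve n).twoIsogenyGeomHom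
        (twoIsogenyGeomHom_smul (congruentNumberCurve n)) c = 0 := by
      rw [← map_nsmul]; exact hker
    have hφc : galH1Map (congruentNumberCurve n).twoIsogenyGeomHom
        (twoIsogenyGeomHom_smul (congruentNumberCurve n)) c = 0 :=
      hA _ (galH1Map_mem_sha (congruentNumberCurve n).twoIsogenyGeomHom (twoIsogenyGeomHom_smul (congruentNumberCurve n))
        (congruentNumberCurve n).twoIsogeny.hasLocalPointsMaps_toAddMonoidHom hc) hker'
    have hcker : c ∈ (galH1Map (congruentNumberCurve n).twoIsogenyGeomHom
        (twoIsogenyGeomHom_smul (congruentNumberCurve n))).ker := hφc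
    have hc' : c ∈ (congruentNumberCurve n).sha ⊓
        AddMonoidHom.range (G := Additive (SqUnits ℚ)) (congruentNumberCurve n).twoIsogenyTorsorHom := by
      refine ⟨hc, ?_⟩
      rw [range_twoIsogenyTorsorHom_eq_ker_galH1Map]
      exact hcker
    rw [← hEq] at hc'
    exact AddSubgroup.torsionBy.nsmul_iff.mp hc'.2
  -- (e) `Ш(E_n)[4] = Ш(E_n)[2]` as subgroups of `Ш`, so `#Ш[4] = 4` and `#Sel₄ = 4·4·4`
  have h42 : AddSubgroup.torsionBy (↥(congruentNumberCurve n).sha) ((4 : ℕ) : ℤ) =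
      AddSubgroup.torsionBy (↥(congruentNumberCurve n).sha) ((2 : ℕ) : ℤ) := by
    ext x
    rw [AddSubgroup.torsionBy.nsmul_iff, AddSubgroup.torsionBy.nsmul_iff]
    constructor
    · intro hx
      have hx' : 2 • (2 • (x : (congruentNumberCurve n).galH1)) = 0 := by
        rw [← mul_nsmul]
        have := congrArg Subtype.val hx
        simpa using this
      exact Subtype.ext (by simpa using hstep x x.2 hx')
    · intro hx
      rw [show (4 : ℕ) = 2 * 2 by norm_num, mul_nsmul, hx, nsmul_zero]
  have hsha2 : Nat.card (AddSubgroup.torsionBy (↥(congruentNumberCurve n).sha) (2 : ℤ)) = 4 := by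
    have h := (MonskySelmerParity.natCard_shaTorsionBy_two_eq_pow hn (s := 3) (by simpa using h₂)).2
    rw [hr] at h
    simpa using h
  have hsha4 : Nat.card (AddSubgroup.torsionBy (↥(congruentNumberCurve n).sha) ((4 : ℕ) : ℤ)) = 4 := by
    rw [h42]; simpa using hsha2
  have hsel := (congruentNumberCurve n).natCard_selmerGroup_eq_of_natCard_eq four_ne_zero (t := 4) (c := 4)
    (by convert natCard_torsionBy_four_congruentNumberCurve hsq; norm_num) hsha4
  rw [hr] at hsel
  simp only [Nat.cast_ofNat] at hsel
  have h₄ : Nat.card ((congruentNumberCurve n).selmerGroup 4) = 2 ^ 6 := by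
    rw [hsel]; norm_num
  exact ⟨hρ, natCard_primaryComponent_sha_two_eq_four_of_selmerFour n hsq hr h₂ h₄, h₄⟩

/-- **CASSELS' `ρ`-RELATION ON THE TWO-PRIME-SHAPED CLASS** (granted the functorial Cassels–Tate pairing and `Ш(E_n)` finite):
for square-free `n > 1` with `rank E_n(ℚ) = 1` and the Selmer dimensions `dim S(0,−n²) = 3`, `dim S'(0,−n²) = 2` (the shape of the
block-free two-prime sector R2: `Sel^{(φ̂)} = ⟨−1, l, q⟩`, `Sel^{(φ)} = {1, 2, l, 2l}`),

  `#Ш(E_n)[2^∞] = #Ш(A_n)[2^∞]` if `ρ(n) = 0`,   `#Ш(E_n)[2^∞] = 4 · #Ш(A_n)[2^∞]` if `ρ(n) ≠ 0`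

— i.e. `#Ш(E_n)[2^∞] = 4^{ρ(n)} · #Ш(A_n)[2^∞]`, the relation used numerically by the lineage (g15, 1568/1568), now a theorem modulo
Milne I.6.9/6.10(a)/6.13(a). [cite: MilneADT2006, Ch. I, proof of Thm. 7.3 (p. 98), Rem. 6.10(a), Thm. 6.13(a)]
[cite: TianYuanZhang2017, §1 (ρ(n))] [cite: SilvermanAEC2009, Thm. X.4.2(a), Prop. X.4.9] -/
theorem card_shaTwo_eq_of_rho_of_casselsTate {n : ℕ} (hsq : Squarefree n) (hn1 : 1 < n)
    (hCT : exists_casselsTate_pairing_adjoint ℚ)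
    (hfin : haveI := isElliptic_congruentNumberCurve hsq.ne_zero; Finite (congruentNumberCurve n).sha)
    (hr : haveI := isElliptic_congruentNumberCurve hsq.ne_zero; (congruentNumberCurve n).mordellWeilRank = 1)
    (hS : twoIsogenySelmerRank 0 (-((n : ℤ) ^ 2)) = 3) (hS' : twoIsogenySelmerRank' 0 (-((n : ℤ) ^ 2)) = 2) :
    haveI := isElliptic_congruentNumberCurve hsq.ne_zero
    ((rhoSubgroup n).index = 1 →
        Nat.card (AddCommGroup.primaryComponent (congruentNumberCurve n).sha 2) =
          Nat.card (AddCommGroup.primaryComponent (congruentNumberCurve n).twoIsogenyCodomain.sha 2)) ∧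
      ((rhoSubgroup n).index ≠ 1 →
        Nat.card (AddCommGroup.primaryComponent (congruentNumberCurve n).sha 2) =
          4 * Nat.card (AddCommGroup.primaryComponent (congruentNumberCurve n).twoIsogenyCodomain.sha 2)) := by
  have hn := hsq.ne_zero
  haveI := isElliptic_congruentNumberCurve hn
  have h := card_shaTwo_congruent_mul_eq_of_casselsTate hn hCT hfin
  rw [hr, hS, hS'] at h
  obtain ⟨h0, h1⟩ := natCard_range_xSqClass_eq_of_rank_one hsq hn1 hr
  refine ⟨fun hρ => ?_, fun hρ => ?_⟩
  · rw [h0 hρ] at h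
    omega
  · rw [h1 hρ] at h
    omega

/-- **THEOREM T2 (with Cassels–Tate): on the jump-one (G) class the partner's `Ш[2^∞]` is DECIDED by `ρ`.** Same shape
(`rank 1`, `dim S = 3`, `dim S' = 2`, `n > 1` square-free, `Ш(E_n)` finite, functorial Cassels–Tate) plus `#Sel₂(E_n) = 2⁵`,
`#Sel₄(E_n) = 2⁶` (`Ш(E_n)[2^∞] ≅ (ℤ/2)²`): `ρ(n) ≠ 0 ⟹ Ш(A_n)[2^∞] = 0` and `ρ(n) = 0 ⟹ #Ш(A_n)[2^∞] = 4`. This is the first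
theorem of the lineage that CONSUMES the hypothesis `#Sel₄(E_n) = 2⁶` (cf. p770682). [cite: MilneADT2006, Ch. I, Thm. 6.13(a), Rem. 6.10(a)]
[cite: SilvermanAEC2009, Thm. X.4.2] [cite: HeathBrown1994SelmerCongruentII, §1] -/
theorem card_partner_shaTwo_of_selmerFour_of_casselsTate {n : ℕ} (hsq : Squarefree n) (hn1 : 1 < n)
    (hCT : exists_casselsTate_pairing_adjoint ℚ)
    (hfin : haveI := isElliptic_congruentNumberCurve hsq.ne_zero; Finite (congruentNumberCurve n).sha)
    (hr : haveI := isElliptic_congruentNumberCurve hsq.ne_zero; (congruentNumberCurve n).mordellWeilRank = 1)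
    (hS : twoIsogenySelmerRank 0 (-((n : ℤ) ^ 2)) = 3) (hS' : twoIsogenySelmerRank' 0 (-((n : ℤ) ^ 2)) = 2)
    (h₂ : haveI := isElliptic_congruentNumberCurve hsq.ne_zero; Nat.card ((congruentNumberCurve n).selmerGroup 2) = 2 ^ 5)
    (h₄ : haveI := isElliptic_congruentNumberCurve hsq.ne_zero; Nat.card ((congruentNumberCurve n).selmerGroup 4) = 2 ^ 6) :
    ((rhoSubgroup n).index ≠ 1 →
        Nat.card (AddCommGroup.primaryComponent (congruentNumberCurve n).twoIsogenyCodomain.sha 2) = 1) ∧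
      ((rhoSubgroup n).index = 1 →
        Nat.card (AddCommGroup.primaryComponent (congruentNumberCurve n).twoIsogenyCodomain.sha 2) = 4) := by
  have hn := hsq.ne_zero
  haveI := isElliptic_congruentNumberCurve hn
  have hE4 := natCard_primaryComponent_sha_two_eq_four_of_selmerFour n hsq hr h₂ h₄
  obtain ⟨h0, h1⟩ := card_shaTwo_eq_of_rho_of_casselsTate hsq hn1 hCT hfin hr hS hS'
  refine ⟨fun hρ => ?_, fun hρ => ?_⟩
  · have := h1 hρ; omega
  · have := h0 hρ; omega

/-- **THEOREM T3 (no Cassels–Tate input): outside the jump-one class the partner always carries `2`-torsion in `Ш`.**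
Square-free `n`, `rank E_n(ℚ) = 1`, `#Sel₂(E_n) = 2⁵`, `dim S'(0,−n²) = 2`; if `#Sel₄(E_n) ≠ 2⁶` (the census B-members:
`Ш(E_n)[4] ≠ Ш(E_n)[2]`), then `Ш(A_n)[2] ≠ 0` (contrapositive of T1). [cite: SilvermanAEC2009, Thm. X.4.2(a), proof of Prop. X.6.2(c)] -/
theorem partner_sha_two_ne_of_not_selmerFour {n : ℕ} (hsq : Squarefree n)
    (hr : haveI := isElliptic_congruentNumberCurve hsq.ne_zero; (congruentNumberCurve n).mordellWeilRank = 1)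
    (h₂ : haveI := isElliptic_congruentNumberCurve hsq.ne_zero; Nat.card ((congruentNumberCurve n).selmerGroup 2) = 2 ^ 5)
    (hS' : twoIsogenySelmerRank' 0 (-((n : ℤ) ^ 2)) = 2)
    (h₄ : haveI := isElliptic_congruentNumberCurve hsq.ne_zero; Nat.card ((congruentNumberCurve n).selmerGroup 4) ≠ 2 ^ 6) :
    ¬ (∀ c ∈ (congruentNumberCurve n).twoIsogenyCodomain.sha, 2 • c = 0 → c = 0) := by
  intro hA
  exact h₄ (rhoIndex_ne_one_and_selmerFour_of_partner hsq hr h₂ hS' hA).2.2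

/-- **THE EQUIVALENCE (headline).** On the two-prime-shaped rank-one class with `#Sel₂(E_n) = 2⁵` (square-free `n > 1`,
`dim S(0,−n²) = 3`, `dim S'(0,−n²) = 2`, `Ш(E_n)` finite), granted the functorial Cassels–Tate pairing over `ℚ`:

  `Ш(A_n)[2] = 0  ⟺  ρ(n) ≠ 0 ∧ #Sel₄(E_n) = 2⁶`.

`⟹` is T1 (no Cassels–Tate needed); `⟸` is T2. So the level-two (`Sel₄`) datum of C⁺ on R2 is traded for the plain `2`-Selmer dimension of
the partner `A_n : Y² = X³ + 4n²X` (`dim Sel₂(A_n/ℚ) = 2`) together with `ρ`; on the census this is the law «`ρ = 1 ⟺ l ≠ x² + 32y²`»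
(g15's `RhoLawR2`, 636/636) re-read as «`Ш(A_{lq})[2] = 0 ⟺ ((1+i)/l) = −1`». [cite: MilneADT2006, Ch. I, Thm. 6.13(a), Rem. 6.10(a)]
[cite: SilvermanAEC2009, Thm. X.4.2(a), proof of Prop. X.6.2(c)] [cite: TianYuanZhang2017, §1 (ρ(n))] -/
theorem partner_sha_two_eq_bot_iff_of_casselsTate {n : ℕ} (hsq : Squarefree n) (hn1 : 1 < n)
    (hCT : exists_casselsTate_pairing_adjoint ℚ)
    (hfin : haveI := isElliptic_congruentNumberCurve hsq.ne_zero; Finite (congruentNumberCurve n).sha)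
    (hr : haveI := isElliptic_congruentNumberCurve hsq.ne_zero; (congruentNumberCurve n).mordellWeilRank = 1)
    (hS : twoIsogenySelmerRank 0 (-((n : ℤ) ^ 2)) = 3) (hS' : twoIsogenySelmerRank' 0 (-((n : ℤ) ^ 2)) = 2)
    (h₂ : haveI := isElliptic_congruentNumberCurve hsq.ne_zero; Nat.card ((congruentNumberCurve n).selmerGroup 2) = 2 ^ 5) :
    haveI := isElliptic_congruentNumberCurve hsq.ne_zero
    (∀ c ∈ (congruentNumberCurve n).twoIsogenyCodomain.sha, 2 • c = 0 → c = 0) ↔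
      ((rhoSubgroup n).index ≠ 1 ∧ Nat.card ((congruentNumberCurve n).selmerGroup 4) = 2 ^ 6) := by
  have hn := hsq.ne_zero
  haveI := isElliptic_congruentNumberCurve hn
  constructor
  · intro hA
    have h := rhoIndex_ne_one_and_selmerFour_of_partner hsq hr h₂ hS' hA
    exact ⟨h.1, h.2.2⟩
  · rintro ⟨hρ, h₄⟩
    have h1 := (card_partner_shaTwo_of_selmerFour_of_casselsTate hsq hn1 hCT hfin hr hS hS' h₂ h₄).1 hρ
    -- `#Ш(A_n)[2^∞] = 1`: every `2`-torsion class of `Ш(A_n)` is trivial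
    intro c hc h2c
    haveI : Finite (AddCommGroup.primaryComponent (congruentNumberCurve n).twoIsogenyCodomain.sha 2) :=
      Nat.finite_of_card_ne_zero (by rw [h1]; norm_num)
    have hbot : AddCommGroup.primaryComponent (congruentNumberCurve n).twoIsogenyCodomain.sha 2 = ⊥ :=
      AddSubgroup.eq_bot_of_card_eq _ h1
    have hmem : (⟨c, hc⟩ : (congruentNumberCurve n).twoIsogenyCodomain.sha) ∈
        AddCommGroup.primaryComponent (congruentNumberCurve n).twoIsogenyCodomain.sha 2 := by
      rw [AddCommGroup.mem_primaryComponent]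
      have h2c' : 2 • (⟨c, hc⟩ : (congruentNumberCurve n).twoIsogenyCodomain.sha) = 0 := Subtype.ext h2c
      exact ⟨1, by simpa using h2c'⟩
    rw [hbot, AddSubgroup.mem_bot] at hmem
    exact congrArg Subtype.val hmem

/-- **OfFacts form for the route** (GZK by name supplies `rank E_n(ℚ) = 1` and `Ш(E_n)` finite from `ord_{s=1} L(E_n,s) = 1`): the
equivalence `Ш(A_n)[2] = 0 ⟺ ρ(n) ≠ 0 ∧ #Sel₄(E_n) = 2⁶` on the rank-one two-prime-shaped class, granted
`rank_eq_analyticRank_of_analyticRank_le_one` (conjunct 1 of `𝔅_ram`) and `exists_casselsTate_pairing_adjoint ℚ`.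
[cite: Darmon2004, Thm. 3.22] [cite: MilneADT2006, Ch. I, Thm. 6.13(a), Rem. 6.10(a)] -/
theorem partner_sha_two_eq_bot_iff_of_facts (hGZK : rank_eq_analyticRank_of_analyticRank_le_one)
    (hCT : exists_casselsTate_pairing_adjoint ℚ) {n : ℕ} (hsq : Squarefree n) (hn1 : 1 < n)
    (hr1 : haveI := isElliptic_congruentNumberCurve hsq.ne_zero; (congruentNumberCurve n).analyticRank = 1)
    (hS : twoIsogenySelmerRank 0 (-((n : ℤ) ^ 2)) = 3) (hS' : twoIsogenySelmerRank' 0 (-((n : ℤ) ^ 2)) = 2)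
    (h₂ : haveI := isElliptic_congruentNumberCurve hsq.ne_zero; Nat.card ((congruentNumberCurve n).selmerGroup 2) = 2 ^ 5) :
    haveI := isElliptic_congruentNumberCurve hsq.ne_zero
    (∀ c ∈ (congruentNumberCurve n).twoIsogenyCodomain.sha, 2 • c = 0 → c = 0) ↔
      ((rhoSubgroup n).index ≠ 1 ∧ Nat.card ((congruentNumberCurve n).selmerGroup 4) = 2 ^ 6) := by
  haveI := isElliptic_congruentNumberCurve hsq.ne_zero
  obtain ⟨hrank, hfin⟩ := hGZK (congruentNumberCurve n) (by rw [hr1])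
  rw [hr1] at hrank
  exact partner_sha_two_eq_bot_iff_of_casselsTate hsq hn1 hCT hfin hrank hS hS' h₂

end Summit.BirchSwinnertonDyer.PrintCf2.PartnerSha

end
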